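import Mathlib.LinearAlgebra.RootSystem.Base
import Mathlib.LinearAlgebra.RootSystem.Irreducible
import Mathlib.LinearAlgebra.RootSystem.CartanMatrix
import Mathlib.Combinatorics.SimpleGraph.Connectivity.Connected
import Mathlib.LinearAlgebra.Dual.Lemmas
import HarnessLib

/-!
# Irreducible components of a based root system

For a finite reduced crystallographic root system `P` over a field of characteristic zero with a
base `b`, the **Dynkin graph** on `b.support` (`s ∼ t` iff the Cartan integer `⟨α_s, α_t^∨⟩` is
non-zero) has connected components `c`; the span `M_c` of the simple roots of `c` is invariant
under all reflections (`compSpan_mem_invtRootSubmodule`), every root lies in exactly one `M_c`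
(`exists_unique_root_mem_compSpan`), and the roots in `M_c` form an **irreducible root system
`compSystem b c`** on `M_c` (paired with its dual), with base `compBase b c` supported on `c` and
Cartan matrix the `c`-block of that of `b` (`cartanMatrix_compBase`). This is the decomposition
of a root system into irreducible components (Bourbaki, *Lie*, VI §1.2; Humphreys §10.4, §11.3),
needed to feed Mathlib's Geck construction (stated for irreducible systems) with an arbitrary
reduced root datum in Chevalley's existence theorem
(`Literature.NumberTheory.Automorphic.chevalley_existence`). Everything is proved; the statements
are [folklore].

## Mathlib

`RootPairing.invtRootSubmodule`, `RootPairing.Base.forall_mem_support_invtSubmodule_iff`,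
`RootPairing.IsIrreducible.mk'`, `RootPairing.eq_top_of_mem_invtSubmodule_of_forall_eq_univ`,
`SimpleGraph.ConnectedComponent`. Mathlib has irreducibility but no decomposition into
components.
-/

noncomputable section

open Module Set Function Submodule

namespace Literature.LinearAlgebra.RootSystem

variable {ι K M N : Type*} [Field K] [CharZero K] [AddCommGroup M] [Module K M]
  [AddCommGroup N] [Module K N] [Fintype ι] [DecidableEq ι]
  {P : RootPairing ι K M N} [P.IsCrystallographic] [P.IsReduced] [P.IsRootSystem]
  (b : P.Base)

variable [FiniteDimensional K M]

namespace Base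

/-! ### The Dynkin graph of a base and its components -/

/-- **The Dynkin graph** of a base: `s ∼ t` iff `s ≠ t` and the Cartan integer `⟨α_s, α_t^∨⟩`
is non-zero. [folklore] -/
def dynkinGraph : SimpleGraph b.support :=
  SimpleGraph.fromRel fun s t => b.cartanMatrix s t ≠ 0

omit [Fintype ι] [DecidableEq ι] [P.IsReduced] [P.IsRootSystem] [FiniteDimensional K M] in
/-- Adjacency in the Dynkin graph. [folklore] -/
lemma dynkinGraph_adj {s t : b.support} :
    (dynkinGraph b).Adj s t ↔ s ≠ t ∧ b.cartanMatrix s t ≠ 0 := by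
  rw [dynkinGraph, SimpleGraph.fromRel_adj]
  refine and_congr_right fun hst => ⟨fun h => h.elim id fun h' h0 => h' ?_, fun h => Or.inl h⟩
  rw [RootPairing.Base.cartanMatrix, RootPairing.Base.cartanMatrixIn_def] at h0 ⊢
  have := (P.pairingIn_eq_zero_iff (S := ℤ) (i := (s : ι)) (j := (t : ι))).1 h0
  exact this

/-- The type of **irreducible components** of the base (connected components of the Dynkin
graph). [folklore] -/
abbrev Comp : Type _ := (dynkinGraph b).ConnectedComponent

/-- The component of a simple root. [folklore] -/
abbrev comp (s : b.support) : Comp b := (dynkinGraph b).connectedComponentMk s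

omit [Fintype ι] [DecidableEq ι] [P.IsReduced] [P.IsRootSystem] [FiniteDimensional K M] in
/-- Non-adjacent simple roots in different components are orthogonal: `⟨α_s, α_t^∨⟩ = 0`.
[folklore] -/
lemma pairing_eq_zero_of_comp_ne {s t : b.support} (h : comp b s ≠ comp b t) :
    P.pairing s t = 0 := by
  by_contra h0
  apply h
  have hst : s ≠ t := by rintro rfl; exact h rfl
  have hadj : (dynkinGraph b).Adj s t := by
    rw [dynkinGraph_adj]
    refine ⟨hst, fun h1 => h0 ?_⟩
    rw [RootPairing.Base.cartanMatrix, RootPairing.Base.cartanMatrixIn_def] at h1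
    rw [← P.algebraMap_pairingIn ℤ, h1, map_zero]
  exact SimpleGraph.ConnectedComponent.sound hadj.reachable

/-- **The span `M_c` of the simple roots of the component `c`.** [folklore] -/
def compSpan (c : Comp b) : Submodule K M :=
  span K (P.root '' {i | ∃ h : i ∈ b.support, comp b ⟨i, h⟩ = c})

omit [CharZero K] [Fintype ι] [DecidableEq ι] [P.IsReduced] [P.IsRootSystem] [FiniteDimensional K M] in
/-- Simple roots of `c` lie in `M_c`. [folklore] -/
lemma root_mem_compSpan (s : b.support) : P.root s ∈ compSpan b (comp b s) :=
  subset_span ⟨s, ⟨s.2, rfl⟩, rfl⟩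

omit [DecidableEq ι] [P.IsRootSystem] [FiniteDimensional K M] in
/-- **`M_c` is invariant under all reflections of `P`** (check on simple reflections: `s_t`
fixes `α_s` for `t` in another component, and maps it into `M_c` otherwise). [folklore] -/
theorem compSpan_mem_invtRootSubmodule (c : Comp b) : compSpan b c ∈ P.invtRootSubmodule := by
  rw [RootPairing.mem_invtRootSubmodule_iff, ← b.forall_mem_support_invtSubmodule_iff]
  intro t ht
  rw [Module.End.mem_invtSubmodule, compSpan, span_le]
  rintro _ ⟨s, ⟨hs, hsc⟩, rfl⟩
  rw [SetLike.mem_coe, mem_comap, LinearEquiv.coe_coe, RootPairing.reflection_apply_root]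
  by_cases hct : comp b ⟨t, ht⟩ = c
  · exact sub_mem (subset_span ⟨s, ⟨hs, hsc⟩, rfl⟩)
      (smul_mem _ _ (subset_span ⟨t, ⟨ht, hct⟩, rfl⟩))
  · have h0 : P.pairing s t = 0 :=
      pairing_eq_zero_of_comp_ne b (s := ⟨s, hs⟩) (t := ⟨t, ht⟩) (by rw [hsc]; exact Ne.symm hct)
    rw [h0, zero_smul, sub_zero]
    exact subset_span ⟨s, ⟨hs, hsc⟩, rfl⟩

omit [CharZero K] [Fintype ι] [DecidableEq ι] [P.IsReduced] [FiniteDimensional K M] in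
/-- `M_c` is spanned by the part of the weight basis indexed by `c`. [folklore] -/
lemma compSpan_eq_span_image (c : Comp b) :
    compSpan b c = span K (b.toWeightBasis '' {s | comp b s = c}) := by
  rw [compSpan]
  congr 1
  ext x
  constructor
  · rintro ⟨i, ⟨hi, hic⟩, rfl⟩
    exact ⟨⟨i, hi⟩, hic, by simp⟩
  · rintro ⟨s, hsc, rfl⟩
    exact ⟨s, ⟨s.2, hsc⟩, by simp⟩

omit [CharZero K] [Fintype ι] [DecidableEq ι] [P.IsReduced] [FiniteDimensional K M] in
/-- **Membership in `M_c` in coordinates**: all non-zero coordinates in the basis of simple roots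
are at simple roots of `c`. [folklore] -/
theorem mem_compSpan_iff {c : Comp b} {x : M} :
    x ∈ compSpan b c ↔ ∀ s : b.support, b.toWeightBasis.repr x s ≠ 0 → comp b s = c := by
  rw [compSpan_eq_span_image, Module.Basis.mem_span_image]
  simp only [Set.subset_def, Finset.mem_coe, Finsupp.mem_support_iff, mem_setOf_eq]

omit [CharZero K] [Fintype ι] [DecidableEq ι] [P.IsReduced] [FiniteDimensional K M] in
/-- `M_c ∩ M_{c'} = 0` for `c ≠ c'`. [folklore] -/
theorem eq_zero_of_mem_compSpan_of_mem_compSpan {c c' : Comp b} (hcc' : c ≠ c') {x : M}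
    (hx : x ∈ compSpan b c) (hx' : x ∈ compSpan b c') : x = 0 := by
  rw [mem_compSpan_iff] at hx hx'
  apply b.toWeightBasis.repr.injective
  rw [map_zero]
  ext s
  by_contra h
  exact hcc' ((hx s h).symm.trans (hx' s h))

omit [CharZero K] [Fintype ι] [DecidableEq ι] [P.IsReduced] [FiniteDimensional K M] in
/-- Every `x ∈ M` is the sum of its components `x_c ∈ M_c`. [folklore] -/
theorem exists_sum_mem_compSpan (x : M) :
    ∃ f : Comp b → M, (∀ c, f c ∈ compSpan b c) ∧ x = ∑ c, f c := by
  classical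
  refine ⟨fun c => ∑ s ∈ Finset.univ.filter (fun s => comp b s = c),
    b.toWeightBasis.repr x s • b.toWeightBasis s, fun c => ?_, ?_⟩
  · refine Submodule.sum_mem _ fun s hs => smul_mem _ _ ?_
    rw [Finset.mem_filter] at hs
    rw [RootPairing.Base.toWeightBasis_apply, ← hs.2]
    exact root_mem_compSpan b s
  · change x = ∑ c, ∑ s ∈ Finset.univ.filter (fun s => comp b s = c),
      b.toWeightBasis.repr x s • b.toWeightBasis s
    rw [Finset.sum_fiberwise Finset.univ (comp b)
      (fun s => b.toWeightBasis.repr x s • b.toWeightBasis s)]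
    exact (b.toWeightBasis.sum_repr x).symm

omit [DecidableEq ι] [FiniteDimensional K M] in
/-- **A coroot whose root lies in `M_c` kills `M_{c'}` for `c' ≠ c`** (invariance of `M_{c'}`
under the reflection, and `M_c ∩ M_{c'} = 0`). [folklore] -/
theorem coroot'_apply_eq_zero_of_root_mem {c c' : Comp b} (hcc' : c ≠ c') {i : ι}
    (hi : P.root i ∈ compSpan b c) {x : M} (hx : x ∈ compSpan b c') : P.coroot' i x = 0 := by
  have hinv := (RootPairing.mem_invtRootSubmodule_iff P).1 (compSpan_mem_invtRootSubmodule b c') i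
  rw [Module.End.mem_invtSubmodule] at hinv
  have h1 : P.reflection i x ∈ compSpan b c' := hinv hx
  rw [RootPairing.reflection_apply] at h1
  have h2 : (P.coroot' i x) • P.root i ∈ compSpan b c' := by
    have := sub_mem hx h1
    rwa [sub_sub_cancel] at this
  by_contra h0
  have h3 : P.root i ∈ compSpan b c' := by
    have := smul_mem _ (P.coroot' i x)⁻¹ h2
    rwa [smul_smul, inv_mul_cancel₀ h0, one_smul] at this
  exact P.ne_zero i (eq_zero_of_mem_compSpan_of_mem_compSpan b hcc' hi h3)

omit [DecidableEq ι] [FiniteDimensional K M] in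
/-- **Every root lies in some `M_c`.** [folklore] -/
theorem exists_root_mem_compSpan (i : ι) : ∃ c, P.root i ∈ compSpan b c := by
  obtain ⟨f, hf, hsum⟩ := exists_sum_mem_compSpan b (P.root i)
  have h2 : P.coroot' i (P.root i) ≠ 0 := by
    rw [P.root_coroot'_eq_pairing, P.pairing_same]; exact two_ne_zero
  have h3 : ∃ c, P.coroot' i (f c) ≠ 0 := by
    by_contra! h
    apply h2
    rw [hsum, map_sum]
    exact Finset.sum_eq_zero fun c _ => h c
  obtain ⟨c, hc⟩ := h3
  refine ⟨c, ?_⟩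
  have hinv := (RootPairing.mem_invtRootSubmodule_iff P).1 (compSpan_mem_invtRootSubmodule b c) i
  rw [Module.End.mem_invtSubmodule] at hinv
  have h1 : P.reflection i (f c) ∈ compSpan b c := hinv (hf c)
  rw [RootPairing.reflection_apply] at h1
  have h4 : (P.coroot' i (f c)) • P.root i ∈ compSpan b c := by
    have := sub_mem (hf c) h1
    rwa [sub_sub_cancel] at this
  have := smul_mem _ (P.coroot' i (f c))⁻¹ h4
  rwa [smul_smul, inv_mul_cancel₀ hc, one_smul] at this

/-- **The component of a root**: the unique `c` with `α_i ∈ M_c`. [folklore] -/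
def rootComp (i : ι) : Comp b := (exists_root_mem_compSpan b i).choose

omit [DecidableEq ι] [FiniteDimensional K M] in
/-- `α_i ∈ M_{rootComp i}`. [folklore] -/
lemma root_mem_compSpan_rootComp (i : ι) : P.root i ∈ compSpan b (rootComp b i) :=
  (exists_root_mem_compSpan b i).choose_spec

omit [DecidableEq ι] [FiniteDimensional K M] in
/-- The component of a root is characterised by `α_i ∈ M_c`. [folklore] -/
lemma rootComp_eq_iff {i : ι} {c : Comp b} : rootComp b i = c ↔ P.root i ∈ compSpan b c := by
  refine ⟨fun h => h ▸ root_mem_compSpan_rootComp b i, fun h => ?_⟩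
  by_contra hne
  exact P.ne_zero i (eq_zero_of_mem_compSpan_of_mem_compSpan b hne
    (root_mem_compSpan_rootComp b i) h)

omit [DecidableEq ι] [FiniteDimensional K M] in
/-- The component of a simple root is its graph component. [folklore] -/
@[simp] lemma rootComp_coe (s : b.support) : rootComp b (s : ι) = comp b s :=
  (rootComp_eq_iff b).2 (root_mem_compSpan b s)

omit [DecidableEq ι] [FiniteDimensional K M] in
/-- `rootComp (s_i j) = rootComp j`: reflections preserve each `M_c`. [folklore] -/
lemma rootComp_reflectionPerm (i j : ι) : rootComp b (P.reflectionPerm i j) = rootComp b j := by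
  rw [rootComp_eq_iff, P.root_reflectionPerm]
  have hinv := (RootPairing.mem_invtRootSubmodule_iff P).1
    (compSpan_mem_invtRootSubmodule b (rootComp b j)) i
  rw [Module.End.mem_invtSubmodule] at hinv
  exact hinv (root_mem_compSpan_rootComp b j)

omit [DecidableEq ι] [FiniteDimensional K M] in
/-- **Roots of different components are orthogonal**: `⟨α_j, α_i^∨⟩ = 0`. [folklore] -/
theorem pairing_eq_zero_of_rootComp_ne {i j : ι} (h : rootComp b i ≠ rootComp b j) :
    P.pairing j i = 0 := by
  rw [← P.root_coroot'_eq_pairing]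
  exact coroot'_apply_eq_zero_of_root_mem b h (root_mem_compSpan_rootComp b i)
    (root_mem_compSpan_rootComp b j)

/-! ### The root system of a component -/

section CompSystem

variable (c : Comp b)

/-- The indices of the roots of the component `c`. [folklore] -/
abbrev CompIdx : Type _ := {i : ι // rootComp b i = c}

/-- The reflection permutations restrict to the roots of a component. [folklore] -/
def compReflectionPerm (i : CompIdx b c) : CompIdx b c ≃ CompIdx b c :=
  (P.reflectionPerm (i : ι)).subtypeEquiv fun j => by
    rw [rootComp_reflectionPerm]

/-- The coroot of `i` as a functional on `M_c`. [folklore] -/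
def compCoroot (i : ι) : Module.Dual K (compSpan b c) := (P.coroot' i).domRestrict (compSpan b c)

omit [CharZero K] [Fintype ι] [DecidableEq ι] [P.IsReduced] [P.IsRootSystem] [FiniteDimensional K M] in
/-- Unfolding of `compCoroot`. [folklore] -/
@[simp] lemma compCoroot_apply (i : ι) (x : compSpan b c) : compCoroot b c i x = P.coroot' i x := rfl

omit [DecidableEq ι] [FiniteDimensional K M] in
/-- Coroots of other components vanish on `M_c`. [folklore] -/
lemma compCoroot_eq_zero_of_ne {i : ι} (hi : rootComp b i ≠ c) : compCoroot b c i = 0 := by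
  ext x
  exact coroot'_apply_eq_zero_of_root_mem b hi (root_mem_compSpan_rootComp b i) x.2

omit [DecidableEq ι] [FiniteDimensional K M] in
/-- A coroot of the component is determined by its restriction to `M_c`. [folklore] -/
lemma coroot'_eq_of_compCoroot_eq {i j : ι} (hi : rootComp b i = c) (hj : rootComp b j = c)
    (h : compCoroot b c i = compCoroot b c j) : P.coroot' i = P.coroot' j := by
  ext x
  obtain ⟨f, hf, rfl⟩ := exists_sum_mem_compSpan b x
  rw [map_sum, map_sum]
  refine Finset.sum_congr rfl fun c' _ => ?_
  by_cases hc' : c' = c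
  · subst hc'
    exact DFunLike.congr_fun h ⟨f c', hf c'⟩
  · rw [coroot'_apply_eq_zero_of_root_mem b (hi.trans_ne (Ne.symm hc')) (root_mem_compSpan_rootComp b i)
        (hf c'),
      coroot'_apply_eq_zero_of_root_mem b (hj.trans_ne (Ne.symm hc')) (root_mem_compSpan_rootComp b j)
        (hf c')]

/-- **The root system `P_c` of the component `c`**: module `M_c`, dual module its dual, roots the
roots of `P` in `M_c`, coroots the restrictions of their coroots. [folklore] -/
def compSystem : RootPairing (CompIdx b c) K (compSpan b c) (Module.Dual K (compSpan b c)) where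
  toLinearMap := Module.Dual.eval K (compSpan b c)
  root := ⟨fun i => ⟨P.root i, (rootComp_eq_iff b).1 i.2⟩, fun i j h => Subtype.ext
    (P.root.injective (congrArg Subtype.val h))⟩
  coroot := ⟨fun i => compCoroot b c i, fun i j h => Subtype.ext (P.coroot.injective
    ((LinearMap.IsPerfPair.bijective_right P.toLinearMap).1
      (coroot'_eq_of_compCoroot_eq b c i.2 j.2 h)))⟩
  root_coroot_two i := by
    change P.coroot' i (P.root i) = 2
    rw [P.root_coroot'_eq_pairing, P.pairing_same]
  reflectionPerm := compReflectionPerm b c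
  reflectionPerm_root i j := by
    apply Subtype.ext
    change P.root j - P.coroot' i (P.root j) • P.root i = P.root (P.reflectionPerm i j)
    rw [P.root_coroot'_eq_pairing]
    exact P.reflectionPerm_root i j
  reflectionPerm_coroot i j := by
    ext x
    change P.toLinearMap x (P.coroot j) - P.toLinearMap (P.root i) (P.coroot j) *
      P.toLinearMap x (P.coroot i) = P.toLinearMap x (P.coroot (P.reflectionPerm i j))
    rw [← P.reflectionPerm_coroot i j, map_sub, map_smul, smul_eq_mul]

omit [DecidableEq ι] in
/-- The roots of `P_c`. [folklore] -/
@[simp] lemma compSystem_root_coe (i : CompIdx b c) : ((compSystem b c).root i : M) = P.root i := rfl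

omit [DecidableEq ι] in
/-- The coroots of `P_c`. [folklore] -/
@[simp] lemma compSystem_coroot (i : CompIdx b c) : (compSystem b c).coroot i = compCoroot b c i := rfl

omit [DecidableEq ι] in
/-- The reflection permutations of `P_c` are those of `P`. [folklore] -/
@[simp] lemma compSystem_reflectionPerm_coe (i j : CompIdx b c) :
    (((compSystem b c).reflectionPerm i j : CompIdx b c) : ι) = P.reflectionPerm i j := rfl

omit [DecidableEq ι] in
/-- **The pairings of `P_c` are those of `P`.** [folklore] -/
@[simp] lemma compSystem_pairing (i j : CompIdx b c) : (compSystem b c).pairing i j = P.pairing i j := by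
  change P.coroot' j (P.root i) = P.pairing i j
  exact P.root_coroot'_eq_pairing j i

/-- `P_c` is crystallographic. [folklore] -/
instance instIsCrystallographicCompSystem : (compSystem b c).IsCrystallographic where
  exists_value i j := by
    obtain ⟨z, hz⟩ := P.exists_value (S := ℤ) i j
    exact ⟨z, by rw [compSystem_pairing]; exact hz⟩

omit [DecidableEq ι] in
/-- `pairingIn ℤ` of `P_c` is that of `P`. [folklore] -/
lemma compSystem_pairingIn (i j : CompIdx b c) :
    (compSystem b c).pairingIn ℤ i j = P.pairingIn ℤ i j := by
  apply FaithfulSMul.algebraMap_injective ℤ K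
  rw [RootPairing.algebraMap_pairingIn, RootPairing.algebraMap_pairingIn, compSystem_pairing]

/-- `P_c` is reduced. [folklore] -/
instance instIsReducedCompSystem : (compSystem b c).IsReduced where
  eq_or_eq_neg i j h := by
    have h' : ¬ LinearIndependent K ![P.root i, P.root j] := by
      intro h2
      apply h
      have e : (compSpan b c).subtype ∘ ![(compSystem b c).root i, (compSystem b c).root j] =
          ![P.root i, P.root j] := by
        funext l; fin_cases l <;> rfl
      rw [← e] at h2
      exact h2.of_comp
    rcases RootPairing.IsReduced.eq_or_eq_neg (i : ι) (j : ι) h' with h3 | h3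
    · left; exact Subtype.ext h3
    · right; exact Subtype.ext h3

omit [DecidableEq ι] in
/-- The roots of `P_c` span `M_c`. [folklore] -/
lemma span_range_compSystem_root : span K (range (compSystem b c).root) = ⊤ := by
  apply Submodule.map_injective_of_injective (compSpan b c).injective_subtype
  rw [Submodule.map_span, Submodule.map_subtype_top]
  refine le_antisymm (span_le.2 ?_) ?_
  · rintro _ ⟨_, ⟨i, rfl⟩, rfl⟩
    exact (rootComp_eq_iff b).1 i.2
  · change span K (P.root '' {i | ∃ h : i ∈ b.support, comp b ⟨i, h⟩ = c}) ≤ _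
    rw [span_le]
    rintro _ ⟨s, ⟨hs, hsc⟩, rfl⟩
    refine subset_span ⟨(compSystem b c).root ⟨s, ?_⟩, ⟨_, rfl⟩, rfl⟩
    rw [← hsc]
    exact rootComp_coe b ⟨s, hs⟩

omit [DecidableEq ι] in
/-- The coroots of `P_c` span the dual of `M_c`. [folklore] -/
lemma span_range_compSystem_coroot : span K (range (compSystem b c).coroot) = ⊤ := by
  rw [eq_top_iff]
  intro φ _
  -- extend `φ` to `M`, write it through a coweight, and expand in coroots
  obtain ⟨Φ, hΦ⟩ := (Subspace.dualRestrict_surjective (W := compSpan b c)) φ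
  obtain ⟨y, rfl⟩ := P.toLinearMap.flip.toPerfPair.surjective Φ
  have hy : y ∈ span K (range P.coroot) := by
    rw [RootPairing.IsRootSystem.span_coroot_eq_top]; exact mem_top
  rw [← hΦ]
  clear hΦ
  induction hy using Submodule.span_induction with
  | mem y hy =>
    obtain ⟨i, rfl⟩ := hy
    by_cases hi : rootComp b i = c
    · refine subset_span ⟨⟨i, hi⟩, ?_⟩
      ext x; rfl
    · have : (compSpan b c).dualRestrict (P.toLinearMap.flip.toPerfPair (P.coroot i)) =
          compCoroot b c i := by ext x; rfl
      rw [this, compCoroot_eq_zero_of_ne b c hi]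
      exact zero_mem _
  | zero => rw [map_zero, map_zero]; exact zero_mem _
  | add y y' _ _ hy hy' => rw [map_add, map_add]; exact add_mem hy hy'
  | smul a y _ hy => rw [map_smul, map_smul]; exact smul_mem _ a hy

/-- **`P_c` is a root system.** [folklore] -/
instance instIsRootSystemCompSystem : (compSystem b c).IsRootSystem where
  span_root_eq_top := span_range_compSystem_root b c
  span_coroot_eq_top := span_range_compSystem_coroot b c

/-- `M_c ≠ 0`. [folklore] -/
instance nontrivial_compSpan : Nontrivial (compSpan b c) := by
  obtain ⟨s, rfl⟩ := c.exists_rep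
  exact ⟨⟨⟨P.root s, root_mem_compSpan b s⟩, 0, fun h => P.ne_zero s (congrArg Subtype.val h)⟩⟩

/-- **`P_c` is irreducible** (the Dynkin graph of `c` is connected). [folklore] -/
instance instIsIrreducibleCompSystem : (compSystem b c).IsIrreducible := by
  refine RootPairing.IsIrreducible.mk' _ fun q hq hq0 => ?_
  refine RootPairing.eq_top_of_mem_invtSubmodule_of_forall_eq_univ _ q hq0 hq fun Φ hΦ hΦq hker => ?_
  -- pairings between `Φ` and its complement vanish
  have horth : ∀ i ∈ Φ, ∀ j ∉ Φ, P.pairing (i : ι) j = 0 := by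
    intro i hi j hj
    have h1 := hker j hj (hΦq ⟨i, hi, rfl⟩)
    rw [LinearMap.mem_ker, RootPairing.root_coroot'_eq_pairing, compSystem_pairing] at h1
    exact h1
  have horth' : ∀ i ∈ Φ, ∀ j ∉ Φ, P.pairing (j : ι) i = 0 := fun i hi j hj =>
    (P.pairing_eq_zero_iff' (i := (i : ι)) (j := (j : ι))).1 (horth i hi j hj)
  -- the simple roots of `c` inside / outside `Φ`
  by_contra hne
  obtain ⟨j, hj⟩ : ∃ j, j ∉ Φ := by
    by_contra! h; exact hne (Set.eq_univ_of_forall h)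
  obtain ⟨i, hi⟩ := hΦ
  -- simple roots of `c` as indices of `P_c`
  let simp' : {s : b.support // comp b s = c} → CompIdx b c :=
    fun s => ⟨s.1, by rw [rootComp_coe]; exact s.2⟩
  by_cases hall : ∀ s, simp' s ∈ Φ
  · -- then `α_j^∨` kills all simple roots: contradiction
    apply (compSystem b c).flip.ne_zero j
    change compCoroot b c j = 0
    have hj0 : ∀ s : b.support, P.pairing (s : ι) j = 0 := by
      intro s
      by_cases hsc : comp b s = c
      · exact horth _ (hall ⟨s, hsc⟩) j hj
      · exact pairing_eq_zero_of_rootComp_ne b (by rw [j.2, rootComp_coe]; exact Ne.symm hsc)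
    ext ⟨x, hx⟩
    change P.coroot' j x = 0
    rw [← b.toWeightBasis.sum_repr x, map_sum]
    refine Finset.sum_eq_zero fun s _ => ?_
    rw [map_smul, RootPairing.Base.toWeightBasis_apply, P.root_coroot'_eq_pairing, hj0 s, smul_zero]
  · by_cases hnone : ∀ s, simp' s ∉ Φ
    · -- then `α_i` is orthogonal to all simple coroots: contradiction
      apply (compSystem b c).ne_zero i
      apply Subtype.ext
      change P.root i = 0
      have hi0 : ∀ s : b.support, P.pairing (i : ι) s = 0 := by
        intro s
        by_cases hsc : comp b s = c
        · exact horth i hi _ (hnone ⟨s, hsc⟩)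
        · have := pairing_eq_zero_of_rootComp_ne b
            (i := (s : ι)) (j := (i : ι)) (by rw [i.2, rootComp_coe]; exact hsc)
          exact this
      refine P.eq_zero_iff_forall_coroot'_eq_zero.2 fun k => ?_
      change P.toLinearMap (P.root i) (P.coroot k) = 0
      rw [← b.toCoweightBasis.sum_repr (P.coroot k), map_sum]
      refine Finset.sum_eq_zero fun s _ => ?_
      rw [map_smul, RootPairing.Base.toCoweightBasis_apply, P.root_coroot_eq_pairing, hi0 s,
        smul_zero]
    · simp only [not_forall, not_not] at hall hnone
      obtain ⟨s, hs⟩ := hall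
      obtain ⟨t, ht⟩ := hnone
      -- a path from `t` (in `Φ`) to `s` (not in `Φ`) inside `c` crosses the boundary
      have hreach : (dynkinGraph b).Reachable t.1 s.1 :=
        SimpleGraph.ConnectedComponent.exact (t.2.trans s.2.symm)
      obtain ⟨p⟩ := hreach
      obtain ⟨d, -, hd1, hd2⟩ := p.exists_boundary_dart {u | ∃ h : comp b u = c, simp' ⟨u, h⟩ ∈ Φ}
        ⟨t.2, ht⟩ (fun ⟨h, h'⟩ => hs h')
      obtain ⟨hu, huΦ⟩ := hd1
      have hadj' := d.adj
      have hadj := hadj'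
      rw [dynkinGraph_adj] at hadj
      have hvc : comp b d.snd = c := by
        rw [← hu]; exact (SimpleGraph.ConnectedComponent.sound hadj'.reachable).symm
      have hvΦ : simp' ⟨d.snd, hvc⟩ ∉ Φ := fun h => hd2 ⟨hvc, h⟩
      apply hadj.2
      rw [RootPairing.Base.cartanMatrix, RootPairing.Base.cartanMatrixIn_def,
        ← (FaithfulSMul.algebraMap_injective ℤ K).eq_iff, RootPairing.algebraMap_pairingIn, map_zero]
      exact horth _ huΦ _ hvΦ

end CompSystem



/-! ### The base of a component -/

section CompBase

variable (c : Comp b)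

/-- A simple root of `c` as an index of `P_c`. [folklore] -/
def simpleIdx (s : b.support) (hs : comp b s = c) : CompIdx b c :=
  ⟨s, by rw [rootComp_coe]; exact hs⟩

/-- Natural-number coordinates in the basis of simple roots. [folklore] -/
def HasNatCoord (x : M) : Prop := ∀ s : b.support, ∃ n : ℕ, b.toWeightBasis.repr x s = n

omit [FiniteDimensional K M] [Fintype ι] [P.IsCrystallographic] [P.IsReduced] in
/-- Elements of the `ℕ`-span of the simple roots have natural-number coordinates. [folklore] -/
lemma hasNatCoord_of_mem_closure {x : M} (hx : x ∈ AddSubmonoid.closure (P.root '' b.support)) :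
    HasNatCoord b x := by
  induction hx using AddSubmonoid.closure_induction with
  | mem x hx =>
    obtain ⟨t, ht, rfl⟩ := hx
    intro s
    rw [show P.root t = b.toWeightBasis ⟨t, ht⟩ by simp, Module.Basis.repr_self]
    by_cases h : (⟨t, ht⟩ : b.support) = s
    · exact ⟨1, by rw [h, Finsupp.single_eq_same, Nat.cast_one]⟩
    · exact ⟨0, by rw [Finsupp.single_apply, if_neg h, Nat.cast_zero]⟩
  | zero => exact fun s => ⟨0, by simp⟩
  | add x y _ _ hx hy =>
    intro s
    obtain ⟨m, hm⟩ := hx s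
    obtain ⟨n, hn⟩ := hy s
    exact ⟨m + n, by rw [map_add, Finsupp.add_apply, hm, hn, Nat.cast_add]⟩

omit [DecidableEq ι] in
/-- An element of `M_c` with natural-number coordinates lies in the `ℕ`-span of the simple roots
of `c` (inside `P_c`). [folklore] -/
lemma mem_closure_of_hasNatCoord (x : compSpan b c) (hn : HasNatCoord b (x : M)) :
    x ∈ AddSubmonoid.closure ((compSystem b c).root '' {i | (i : ι) ∈ b.support}) := by
  classical
  choose n hn using hn
  have hx' := (mem_compSpan_iff b).1 x.2
  have key : x = ∑ s ∈ Finset.univ.filter (fun s => comp b s = c),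
      (n s : K) • (if h : comp b s = c then (compSystem b c).root (simpleIdx b c s h) else 0) := by
    apply Subtype.ext
    rw [Submodule.coe_sum]
    conv_lhs => rw [← b.toWeightBasis.sum_repr (x : M)]
    rw [← Finset.sum_filter_add_sum_filter_not Finset.univ (fun s => comp b s = c)]
    rw [Finset.sum_eq_zero (s := Finset.univ.filter fun s => ¬ comp b s = c), add_zero]
    · refine Finset.sum_congr rfl fun s hs => ?_
      rw [Finset.mem_filter] at hs
      rw [dif_pos hs.2, Submodule.coe_smul, compSystem_root_coe, hn s,
        RootPairing.Base.toWeightBasis_apply]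
      rfl
    · intro s hs
      rw [Finset.mem_filter] at hs
      have : b.toWeightBasis.repr (x : M) s = 0 := by
        by_contra h; exact hs.2 (hx' s h)
      rw [this, zero_smul]
  rw [key]
  refine AddSubmonoid.sum_mem _ fun s hs => ?_
  rw [Nat.cast_smul_eq_nsmul]
  refine AddSubmonoid.nsmul_mem _ ?_ _
  rw [Finset.mem_filter] at hs
  rw [dif_pos hs.2]
  exact AddSubmonoid.subset_closure ⟨_, s.2, rfl⟩

/-- The restriction of coroots to `M_c`, as an additive map `N → Dual K M_c`. [folklore] -/
def corootRes : N →+ Module.Dual K (compSpan b c) :=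
  ((compSpan b c).dualRestrict.comp (P.toLinearMap.flip : N →ₗ[K] Module.Dual K M)).toAddMonoidHom

omit [CharZero K] [Fintype ι] [DecidableEq ι] [P.IsReduced] [P.IsRootSystem] [FiniteDimensional K M] in
/-- `corootRes (α_i^∨) = compCoroot i`. [folklore] -/
lemma corootRes_coroot (i : ι) : corootRes b c (P.coroot i) = compCoroot b c i := by
  ext x; rfl

omit [DecidableEq ι] in
/-- Transfer of `ℕ`-closure membership for coroots. [folklore] -/
lemma corootRes_mem_closure {y : N} (hy : y ∈ AddSubmonoid.closure (P.coroot '' b.support)) :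
    corootRes b c y ∈ AddSubmonoid.closure ((compSystem b c).coroot '' {i | (i : ι) ∈ b.support}) := by
  induction hy using AddSubmonoid.closure_induction with
  | mem y hy =>
    obtain ⟨s, hs, rfl⟩ := hy
    rw [corootRes_coroot]
    by_cases hsc : comp b ⟨s, hs⟩ = c
    · exact AddSubmonoid.subset_closure ⟨simpleIdx b c ⟨s, hs⟩ hsc, hs, rfl⟩
    · have hne : rootComp b s ≠ c := by
        rw [show s = ((⟨s, hs⟩ : b.support) : ι) from rfl, rootComp_coe]; exact hsc
      rw [compCoroot_eq_zero_of_ne b c hne]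
      exact AddSubmonoid.zero_mem _
  | zero => rw [map_zero]; exact AddSubmonoid.zero_mem _
  | add y y' _ _ h h' => rw [map_add]; exact AddSubmonoid.add_mem _ h h'

open scoped Classical in
/-- The simple roots of the component, as a finset of indices of `P_c`. [folklore] -/
def compSupport : Finset (CompIdx b c) := Finset.univ.filter fun i : CompIdx b c => (i : ι) ∈ b.support

omit [FiniteDimensional K M] in
/-- Membership in `compSupport`. [folklore] -/
@[simp] lemma mem_compSupport {i : CompIdx b c} : i ∈ compSupport b c ↔ (i : ι) ∈ b.support := by
  classical
  simp [compSupport]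

/-- The simple roots of the component are linearly independent. [folklore] -/
lemma linearIndepOn_compRoot : LinearIndepOn K (compSystem b c).root (compSupport b c : Set (CompIdx b c)) := by
  have h1 : LinearIndependent K fun i : ↥(compSupport b c : Set (CompIdx b c)) => P.root (i.1 : ι) := by
    have := b.linearIndepOn_root
    refine this.comp (fun i : ↥(compSupport b c : Set (CompIdx b c)) =>
      (⟨(i.1 : ι), (mem_compSupport b c).1 i.2⟩ : b.support)) fun i j h => ?_
    have h' := Subtype.ext_iff.1 h
    exact Subtype.ext (Subtype.ext h')
  exact h1.of_comp (compSpan b c).subtype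

/-- The simple coroots of the component are linearly independent on `M_c`. [folklore] -/
lemma linearIndepOn_compCoroot :
    LinearIndepOn K (compSystem b c).coroot (compSupport b c : Set (CompIdx b c)) := by
  rw [LinearIndepOn, linearIndependent_iff']
  intro S g hg j hj
  have hjs : ((j : CompIdx b c) : ι) ∈ b.support := (mem_compSupport b c).1 j.2
  let y : N := ∑ j ∈ S, g j • P.coroot ((j : CompIdx b c) : ι)
  have hy : y = ∑ j ∈ S, g j • P.coroot ((j : CompIdx b c) : ι) := rfl
  -- the functional of `y` vanishes on `M_c` (hypothesis) and on the other components
  have hflip : P.toLinearMap.flip y = 0 := by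
    ext x
    obtain ⟨f, hf, rfl⟩ := exists_sum_mem_compSpan b x
    rw [LinearMap.zero_apply, map_sum]
    refine Finset.sum_eq_zero fun c' _ => ?_
    rw [hy, map_sum, LinearMap.sum_apply]
    by_cases hc' : c' = c
    · subst hc'
      have := DFunLike.congr_fun hg ⟨f c', hf c'⟩
      rw [LinearMap.zero_apply] at this
      rw [← this]
      simp only [LinearMap.coe_sum, Finset.sum_apply, LinearMap.smul_apply, map_smul,
        compSystem_coroot, compCoroot_apply]
    · refine Finset.sum_eq_zero fun j' _ => ?_
      rw [map_smul, LinearMap.smul_apply]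
      change g j' • P.coroot' _ (f c') = 0
      rw [coroot'_apply_eq_zero_of_root_mem b ((j' : CompIdx b c).2.trans_ne (Ne.symm hc'))
        (root_mem_compSpan_rootComp b _) (hf c'), smul_zero]
  have hy0 : y = 0 :=
    (LinearMap.IsPerfPair.bijective_right P.toLinearMap).1 (by rw [hflip, map_zero])
  -- read off the coefficient of `α_j^∨` in the basis of simple coroots
  have hrepr := congrArg (fun z => b.toCoweightBasis.repr z ⟨_, hjs⟩) hy0
  simp only [hy, map_sum, map_smul, map_zero, Finsupp.coe_zero, Pi.zero_apply,
    Finsupp.coe_finsetSum, Finsupp.coe_smul, Finset.sum_apply, Pi.smul_apply] at hrepr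
  rw [Finset.sum_eq_single j] at hrepr
  · have h1 : P.coroot ((j : CompIdx b c) : ι) = b.toCoweightBasis ⟨_, hjs⟩ := by simp
    rw [h1, Module.Basis.repr_self, Finsupp.single_eq_same, smul_eq_mul, mul_one] at hrepr
    exact hrepr
  · intro j' _ hne
    have hj's : ((j' : CompIdx b c) : ι) ∈ b.support := (mem_compSupport b c).1 j'.2
    have h1 : P.coroot ((j' : CompIdx b c) : ι) = b.toCoweightBasis ⟨_, hj's⟩ := by simp
    rw [h1, Module.Basis.repr_self, Finsupp.single_apply, if_neg, smul_zero]
    intro h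
    apply hne
    have h' := Subtype.ext_iff.1 h
    exact Subtype.ext (Subtype.ext h')
  · intro h; exact absurd hj h

/-- **The base of `P_c` induced by `b`**: the simple roots of the component. [folklore] -/
def compBase : (compSystem b c).Base where
  support := compSupport b c
  linearIndepOn_root := linearIndepOn_compRoot b c
  linearIndepOn_coroot := linearIndepOn_compCoroot b c
  root_mem_or_neg_mem i := by
    rcases b.root_mem_or_neg_mem i with h | h
    · left
      have := mem_closure_of_hasNatCoord b c ((compSystem b c).root i) (hasNatCoord_of_mem_closure b h)
      have e : (compSystem b c).root '' ↑(compSupport b c) =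
          (compSystem b c).root '' {i | (i : ι) ∈ b.support} := by
        congr 1; ext j; simp [compSupport]
      rw [e]
      exact this
    · right
      have h' : -P.root (i : ι) ∈ AddSubmonoid.closure (P.root '' b.support) := h
      have := mem_closure_of_hasNatCoord b c (-(compSystem b c).root i)
        (hasNatCoord_of_mem_closure b h')
      have e : (compSystem b c).root '' ↑(compSupport b c) =
          (compSystem b c).root '' {i | (i : ι) ∈ b.support} := by
        congr 1; ext j; simp [compSupport]
      rw [e]
      exact this
  coroot_mem_or_neg_mem i := by
    rcases b.coroot_mem_or_neg_mem i with h | h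
    · left
      have := corootRes_mem_closure b c h
      rw [corootRes_coroot] at this
      have e : (compSystem b c).coroot '' ↑(compSupport b c) =
          (compSystem b c).coroot '' {i | (i : ι) ∈ b.support} := by
        congr 1; ext j; simp [compSupport]
      rw [e]
      exact this
    · right
      have := corootRes_mem_closure b c h
      rw [map_neg, corootRes_coroot] at this
      have e : (compSystem b c).coroot '' ↑(compSupport b c) =
          (compSystem b c).coroot '' {i | (i : ι) ∈ b.support} := by
        congr 1; ext j; simp [compSupport]
      rw [e]
      exact this

/-- The support of `compBase`. [folklore] -/
@[simp] lemma compBase_support : (compBase b c).support = compSupport b c := rfl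

/-- **The Cartan matrix of the component is the corresponding block of the Cartan matrix of
`b`.** [folklore] -/
theorem cartanMatrix_compBase (s t : (compBase b c).support) :
    (compBase b c).cartanMatrix s t =
      b.cartanMatrix ⟨((s : CompIdx b c) : ι), (mem_compSupport b c).1 s.2⟩
        ⟨((t : CompIdx b c) : ι), (mem_compSupport b c).1 t.2⟩ := by
  change (compSystem b c).pairingIn ℤ s t = P.pairingIn ℤ _ _
  exact compSystem_pairingIn b c _ _

end CompBase

end Base

end Literature.LinearAlgebra.RootSystem
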